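import Literature.NumberTheory.Automorphic.DerivWeightConv
import HarnessLib

/-!
# Moving a derivative past an archimedean unipotent translate: the `Ad(n(-x))` expansion

Topic `NumberTheory/Automorphic`; namespace `Literature.NumberTheory.Automorphic`. Proof file
(auxiliary definitions with bodies — `matE`, `adTerm₁`, `adTerm₂`, `toLie` —, theorems). For a test function `θ` on `GL_2(𝔸_K)`, `x ∈ K_∞` and
`X ∈ 𝔤 = M_2(K_∞)`,

  `(L_{n(x)} θ)_X = L_{n(x)} (θ_{Ad(n(-x)) X})`,  `Ad(n(-x)) X = n(-x) X n(x) = X + x·Y₁(X) + x²·Y₂(X)`,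

with `Y₁(X) = X E - E X`, `Y₂(X) = -E X E`, `E = E₁₂` (`E² = 0`), the products `x·`, `x²·` being the
`K_∞`-module structure of `M_2(K_∞)`; expanding `x = ∑_b x_b b` in the real basis
`stdBasis K` of `K_∞` and using the `ℝ`-linearity of `θ_X` in `X` (`derivWeight_sum_lie`):

* `adInvLie_unipotentGL2` — the matrix identity above;
* `derivWeight_leftTranslate_archUnipotent` — **`(L_{n(x)} θ)_X = L_{n(x)} θ_X
  + ∑_b x_b L_{n(x)} θ_{b·Y₁(X)} + ∑_{b,b'} x_b x_{b'} L_{n(x)} θ_{(b b')·Y₂(X)}`**;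
* `derivWeight_archUnipotentConv_expand` — integrating against a smooth compactly supported kernel
  (`derivWeight_archUnipotentConv`): **`(g₀ ⋆ θ)_X = g₀ ⋆ θ_X + ∑_b (x_b g₀) ⋆ θ_{b·Y₁(X)}
  + ∑_{b,b'} (x_b x_{b'} g₀) ⋆ θ_{(b b')·Y₂(X)}`** — the commutation rule of the Kirillov calculus
  (Jacquet–Shalika (1981), §4; Bump (1997), (2.28)).

## References

* D. Bump, *Automorphic Forms and Representations* (1997), §2.2, (2.28)–(2.29) [Bump1997].
* H. Jacquet, J. A. Shalika, *On Euler products and the classification of automorphic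
  representations I*, Amer. J. Math. 103 (1981), §4 [JacquetShalikaAJM1981].
-/

noncomputable section

open scoped MatrixGroups Classical ContDiff
open NumberField NumberField.mixedEmbedding IsDedekindDomain MeasureTheory

namespace Literature.NumberTheory.Automorphic

variable {K : Type} [Field K] [NumberField K]
  (hcpt : isCompact_glFiniteIntegralLevel 2 K)

set_option backward.isDefEq.respectTransparency false

attribute [local instance 100] LieRing.ofAssociativeRing

open scoped Matrix.Norms.Operator

/-! ### The matrix identity -/

/-- `E = E₁₂ ∈ M_2(K_∞)`. [folklore] -/
abbrev matE : Matrix (Fin 2) (Fin 2) (mixedSpace K) := unipotentDirGL2 (1 : mixedSpace K)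

omit [NumberField K] in
/-- Entry of `E₁₂`. [folklore] -/
@[simp] theorem matE_apply_zero_zero : (matE : Matrix (Fin 2) (Fin 2) (mixedSpace K)) 0 0 = 0 := rfl
omit [NumberField K] in
/-- Entry of `E₁₂`. [folklore] -/
@[simp] theorem matE_apply_zero_one : (matE : Matrix (Fin 2) (Fin 2) (mixedSpace K)) 0 1 = 1 := rfl
omit [NumberField K] in
/-- Entry of `E₁₂`. [folklore] -/
@[simp] theorem matE_apply_one_zero : (matE : Matrix (Fin 2) (Fin 2) (mixedSpace K)) 1 0 = 0 := rfl
omit [NumberField K] in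
/-- Entry of `E₁₂`. [folklore] -/
@[simp] theorem matE_apply_one_one : (matE : Matrix (Fin 2) (Fin 2) (mixedSpace K)) 1 1 = 0 := rfl

omit [NumberField K] in
/-- `x E₁₂ = unipotentDirGL2 x` (the `K_∞`-multiple). [folklore] -/
theorem smul_matE (x : mixedSpace K) : x • (matE : Matrix (Fin 2) (Fin 2) (mixedSpace K)) = unipotentDirGL2 x := by
  refine Matrix.ext fun i j => ?_
  fin_cases i <;> fin_cases j <;> simp [unipotentDirGL2, Matrix.smul_apply]

omit [NumberField K] in
/-- `E₁₂² = 0`. [folklore] -/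
theorem matE_mul_matE : (matE : Matrix (Fin 2) (Fin 2) (mixedSpace K)) * matE = 0 := by
  refine Matrix.ext fun i j => ?_
  fin_cases i <;> fin_cases j <;> simp [Matrix.mul_apply, Fin.sum_univ_two]

omit [NumberField K] in
/-- `n(y) = 1 + y • E`. [folklore] -/
theorem unipotentMatrixGL2_eq (y : mixedSpace K) :
    unipotentMatrixGL2 y = 1 + y • (matE : Matrix (Fin 2) (Fin 2) (mixedSpace K)) := by
  rw [smul_matE]
  exact coe_unipotentGL2_eq_one_add y

/-- The first-order term `Y₁(X) = X E - E X`. [folklore] -/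
def adTerm₁ (X : Matrix (Fin 2) (Fin 2) (mixedSpace K)) : Matrix (Fin 2) (Fin 2) (mixedSpace K) := X * matE - matE * X

/-- The second-order term `Y₂(X) = -E X E` (a `K_∞`-multiple of `E`). [folklore] -/
def adTerm₂ (X : Matrix (Fin 2) (Fin 2) (mixedSpace K)) : Matrix (Fin 2) (Fin 2) (mixedSpace K) := -(matE * X * matE)

omit [NumberField K] in
/-- **`Ad(n(-x)) X = n(-x) X n(x) = X + x·Y₁(X) + x²·Y₂(X)`.** [folklore] -/
theorem unipotent_conj_eq (x : mixedSpace K) (X : Matrix (Fin 2) (Fin 2) (mixedSpace K)) :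
    unipotentMatrixGL2 (-x) * X * unipotentMatrixGL2 x = X + x • adTerm₁ X + (x * x) • adTerm₂ X := by
  rw [unipotentMatrixGL2, unipotentMatrixGL2, coe_unipotentGL2, coe_unipotentGL2, adTerm₁, adTerm₂]
  refine Matrix.ext fun i j => ?_
  fin_cases i <;> fin_cases j <;>
    simp only [Matrix.mul_apply, Fin.sum_univ_two, Matrix.add_apply, Matrix.sub_apply, Matrix.smul_apply,
      Matrix.neg_apply, smul_eq_mul, Matrix.of_apply, Matrix.cons_val', Matrix.cons_val_zero, Matrix.cons_val_one,
      Matrix.empty_val', Matrix.cons_val_fin_one, matE_apply_zero_zero,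
      matE_apply_zero_one, matE_apply_one_zero, matE_apply_one_one, Fin.zero_eta, Fin.mk_one, Fin.isValue] <;>
    ring

/-- The conjugate `Ad(n(x)⁻¹) X` as an element of `𝔤`. [folklore] -/
theorem coe_adInvLie_unipotentGL2 (x : mixedSpace K) (X : (AutomorphyDatum.gl 2 K hcpt).arch.lie) :
    (adInvLie hcpt ((unipotentGL2 x : ↥(upperUnitriangular (Fin 2) (mixedSpace K))) : GL (Fin 2) (mixedSpace K)) X :
        Matrix (Fin 2) (Fin 2) (mixedSpace K)) =
      (X : Matrix (Fin 2) (Fin 2) (mixedSpace K)) + x • adTerm₁ (X : Matrix (Fin 2) (Fin 2) (mixedSpace K)) +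
        (x * x) • adTerm₂ (X : Matrix (Fin 2) (Fin 2) (mixedSpace K)) := by
  rw [coe_adInvLie, ← unipotent_conj_eq, unipotentMatrixGL2, unipotentMatrixGL2, unipotentGL2_neg, Subgroup.coe_inv]

/-- A matrix as an element of `𝔤 = M_2(K_∞)` (the Lie algebra of the `GL_2` datum is everything). [folklore] -/
abbrev toLie (M : Matrix (Fin 2) (Fin 2) (mixedSpace K)) : (AutomorphyDatum.gl 2 K hcpt).arch.lie :=
  ⟨M, mem_gl_arch_lie hcpt M⟩

/-! ### The expansion of the derivative of a unipotent translate -/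

/-- Expansion of a `K_∞`-multiple in the real basis: `x • Y = ∑_b x_b (b • Y)`. [folklore] -/
theorem smul_matrix_eq_sum_repr (x : mixedSpace K) (Y : Matrix (Fin 2) (Fin 2) (mixedSpace K)) :
    x • Y = ∑ b, (stdBasis K).repr x b • ((stdBasis K b) • Y) := by
  conv_lhs => rw [← (stdBasis K).sum_repr x]
  rw [Finset.sum_smul]
  refine Finset.sum_congr rfl fun b _ => ?_
  rw [smul_assoc]

/-- Bilinear expansion in the real basis: `(x x') • Y = ∑_b ∑_{b'} (x_b x'_{b'}) ((b b') • Y)`. [folklore] -/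
theorem mul_smul_matrix_eq_sum_repr (x x' : mixedSpace K) (Y : Matrix (Fin 2) (Fin 2) (mixedSpace K)) :
    (x * x') • Y = ∑ b, ∑ b', ((stdBasis K).repr x b * (stdBasis K).repr x' b') • ((stdBasis K b * stdBasis K b') • Y) := by
  have hx : x * x' = ∑ b, ∑ b', ((stdBasis K).repr x b * (stdBasis K).repr x' b') • (stdBasis K b * stdBasis K b') := by
    conv_lhs => rw [← (stdBasis K).sum_repr x, ← (stdBasis K).sum_repr x']
    rw [Finset.sum_mul_sum]
    refine Finset.sum_congr rfl fun b _ => Finset.sum_congr rfl fun b' _ => ?_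
    rw [smul_mul_smul_comm]
  rw [hx, Finset.sum_smul]
  refine Finset.sum_congr rfl fun b _ => ?_
  rw [Finset.sum_smul]
  refine Finset.sum_congr rfl fun b' _ => ?_
  rw [smul_assoc]

set_option maxHeartbeats 1000000 in
/-- **The conjugated derivative expanded** (pointwise): for a test function `θ`,
`θ_{Ad(n(x)⁻¹)X}(h) = θ_X(h) + ∑_b x_b θ_{b·Y₁}(h) + ∑_b ∑_{b'} x_b x_{b'} θ_{(b b')·Y₂}(h)`. [folklore] -/
theorem derivWeight_adInvLie_unipotent_apply {θ : GL (Fin 2) (AdeleRing (𝓞 K) K) → ℝ}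
    (hθ : IsTestFunctionGL 2 K θ) (X : (AutomorphyDatum.gl 2 K hcpt).arch.lie) (x : mixedSpace K)
    (h : (AdelicGroupData.gl 2 K).Adelic) :
    derivWeight (AutomorphyDatum.gl 2 K hcpt).ofArch
        (adInvLie hcpt ((unipotentGL2 x : ↥(upperUnitriangular (Fin 2) (mixedSpace K))) : GL (Fin 2) (mixedSpace K)) X) θ h =
      derivWeight (AutomorphyDatum.gl 2 K hcpt).ofArch X θ h +
        ∑ b, (stdBasis K).repr x b *
          derivWeight (AutomorphyDatum.gl 2 K hcpt).ofArch
            (toLie hcpt ((stdBasis K b) • adTerm₁ (X : Matrix (Fin 2) (Fin 2) (mixedSpace K)))) θ h +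
        ∑ b, ∑ b', ((stdBasis K).repr x b * (stdBasis K).repr x b') *
          derivWeight (AutomorphyDatum.gl 2 K hcpt).ofArch
            (toLie hcpt ((stdBasis K b * stdBasis K b') • adTerm₂ (X : Matrix (Fin 2) (Fin 2) (mixedSpace K)))) θ h := by
  simp only [derivWeight_eq_fderiv_leftArchSlice hcpt hθ]
  rw [coe_adInvLie_unipotentGL2, smul_matrix_eq_sum_repr x (adTerm₁ _), mul_smul_matrix_eq_sum_repr x x (adTerm₂ _)]
  simp only [neg_add, map_add, ← Finset.sum_neg_distrib, map_sum, ← smul_neg, map_smul, smul_eq_mul]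

/-- **`(L_{n(x)} θ)_X` expanded**: for a test function `θ`,
`(L_{n(x)} θ)_X = L_{n(x)} (θ_X + ∑_b x_b θ_{b·Y₁} + ∑_b ∑_{b'} x_b x_{b'} θ_{(b b')·Y₂})`.
[cite: Bump1997, (2.29) (PDF p. 279)] -/
theorem derivWeight_leftTranslate_archUnipotent {θ : GL (Fin 2) (AdeleRing (𝓞 K) K) → ℝ}
    (hθ : IsTestFunctionGL 2 K θ) (X : (AutomorphyDatum.gl 2 K hcpt).arch.lie) (x : mixedSpace K)
    (h : (AdelicGroupData.gl 2 K).Adelic) :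
    derivWeight (AutomorphyDatum.gl 2 K hcpt).ofArch X (leftTranslateWeight (n := 2) (archUnipotentGL K x) θ) h =
      leftTranslateWeight (n := 2) (archUnipotentGL K x) (derivWeight (AutomorphyDatum.gl 2 K hcpt).ofArch X θ) h +
        ∑ b, (stdBasis K).repr x b *
          leftTranslateWeight (n := 2) (archUnipotentGL K x) (derivWeight (AutomorphyDatum.gl 2 K hcpt).ofArch
            (toLie hcpt ((stdBasis K b) • adTerm₁ (X : Matrix (Fin 2) (Fin 2) (mixedSpace K)))) θ) h +
        ∑ b, ∑ b', ((stdBasis K).repr x b * (stdBasis K).repr x b') *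
          leftTranslateWeight (n := 2) (archUnipotentGL K x) (derivWeight (AutomorphyDatum.gl 2 K hcpt).ofArch
            (toLie hcpt ((stdBasis K b * stdBasis K b') • adTerm₂ (X : Matrix (Fin 2) (Fin 2) (mixedSpace K)))) θ) h := by
  rw [derivWeight_leftTranslateWeight hcpt hθ X, toMixed_archUnipotentGL]
  simp only [leftTranslateWeight_apply]
  exact derivWeight_adInvLie_unipotent_apply hcpt hθ X x _

/-- Left translation commutes with the pointwise linear structure of weights. [folklore] -/
theorem leftTranslateWeight_add (g : (AdelicGroupData.gl 2 K).Adelic) (η η' : (AdelicGroupData.gl 2 K).Adelic → ℝ) :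
    leftTranslateWeight (n := 2) g (η + η') = leftTranslateWeight (n := 2) g η + leftTranslateWeight (n := 2) g η' := rfl

/-- Left translation commutes with scalar multiplication of weights. [folklore] -/
theorem leftTranslateWeight_smul (g : (AdelicGroupData.gl 2 K).Adelic) (c : ℝ) (η : (AdelicGroupData.gl 2 K).Adelic → ℝ) :
    leftTranslateWeight (n := 2) g (c • η) = c • leftTranslateWeight (n := 2) g η := rfl

/-- Left translation commutes with finite sums of weights. [folklore] -/
theorem leftTranslateWeight_sum (g : (AdelicGroupData.gl 2 K).Adelic) {ι' : Type*} (s : Finset ι')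
    (η : ι' → (AdelicGroupData.gl 2 K).Adelic → ℝ) :
    leftTranslateWeight (n := 2) g (∑ i ∈ s, η i) = ∑ i ∈ s, leftTranslateWeight (n := 2) g (η i) := by
  funext k
  simp only [leftTranslateWeight_apply, Finset.sum_apply]

/-- The integrand `x ↦ g₀(x) q(x) (L_{n(x)} θ')(h)` of a polynomially weighted convolution is
integrable, for `θ'` a test function. [folklore] -/
theorem integrable_kernel_mul_leftTranslate {θ' : GL (Fin 2) (AdeleRing (𝓞 K) K) → ℝ} (hθ' : IsTestFunctionGL 2 K θ')
    {g₀ : mixedSpace K → ℝ} (hg₀ : Continuous g₀) (hg₀s : HasCompactSupport g₀) {q : mixedSpace K → ℝ}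
    (hq : Continuous q) (h : (AdelicGroupData.gl 2 K).Adelic) :
    Integrable fun x => g₀ x * q x * leftTranslateWeight (n := 2) (archUnipotentGL K x) θ' h := by
  refine Continuous.integrable_of_hasCompactSupport ?_ ?_
  · refine (hg₀.mul hq).mul ?_
    simp only [leftTranslateWeight_apply]
    exact hθ'.continuous.comp ((continuous_archUnipotentAdelic.inv).mul continuous_const)
  · exact (hg₀s.mul_right).mul_right

set_option maxHeartbeats 4000000 in
/-- **The commutation rule**: for a test function `θ` and a `C^∞` compactly supported kernel `g₀`,
`(g₀ ⋆ θ)_X = g₀ ⋆ θ_X + ∑_b (x_b g₀) ⋆ θ_{b·Y₁(X)} + ∑_b ∑_{b'} (x_b x_{b'} g₀) ⋆ θ_{(b b')·Y₂(X)}`.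
[cite: JacquetShalikaAJM1981, §4] -/
theorem derivWeight_archUnipotentConv_expand {θ : GL (Fin 2) (AdeleRing (𝓞 K) K) → ℝ} (hθ : IsTestFunctionGL 2 K θ)
    {g₀ : mixedSpace K → ℝ} (hg₀ : ContDiff ℝ ∞ g₀) (hg₀s : HasCompactSupport g₀)
    (X : (AutomorphyDatum.gl 2 K hcpt).arch.lie) :
    derivWeight (AutomorphyDatum.gl 2 K hcpt).ofArch X (archUnipotentConv g₀ θ) =
      archUnipotentConv g₀ (derivWeight (AutomorphyDatum.gl 2 K hcpt).ofArch X θ) +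
        ∑ b, archUnipotentConv (fun x => (stdBasis K).repr x b * g₀ x)
          (derivWeight (AutomorphyDatum.gl 2 K hcpt).ofArch
            (toLie hcpt ((stdBasis K b) • adTerm₁ (X : Matrix (Fin 2) (Fin 2) (mixedSpace K)))) θ) +
        ∑ b, ∑ b', archUnipotentConv (fun x => (stdBasis K).repr x b * (stdBasis K).repr x b' * g₀ x)
          (derivWeight (AutomorphyDatum.gl 2 K hcpt).ofArch
            (toLie hcpt ((stdBasis K b * stdBasis K b') • adTerm₂ (X : Matrix (Fin 2) (Fin 2) (mixedSpace K)))) θ) := by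
  funext h
  rw [derivWeight_archUnipotentConv hcpt hθ hg₀ hg₀s X h]
  simp_rw [derivWeight_leftTranslate_archUnipotent hcpt hθ X]
  simp only [Pi.add_apply, Finset.sum_apply, mul_add, Finset.mul_sum]
  -- continuity of the coordinate functions
  have hcoord : ∀ b, Continuous fun x : mixedSpace K => (stdBasis K).repr x b := fun b =>
    ((stdBasis K).coord b).continuous_of_finiteDimensional
  -- integrability of every term
  have hI0 : Integrable fun x => g₀ x * leftTranslateWeight (n := 2) (archUnipotentGL K x)
      (derivWeight (AutomorphyDatum.gl 2 K hcpt).ofArch X θ) h := by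
    simpa only [mul_one] using integrable_kernel_mul_leftTranslate (isTestFunctionGL_derivWeight hcpt hθ X)
      hg₀.continuous hg₀s continuous_const (q := fun _ => (1 : ℝ)) h
  have hI1 : ∀ b, Integrable fun x => g₀ x * ((stdBasis K).repr x b *
      leftTranslateWeight (n := 2) (archUnipotentGL K x) (derivWeight (AutomorphyDatum.gl 2 K hcpt).ofArch
        (toLie hcpt ((stdBasis K b) • adTerm₁ (X : Matrix (Fin 2) (Fin 2) (mixedSpace K)))) θ) h) := by
    intro b
    simpa only [mul_assoc] using integrable_kernel_mul_leftTranslate (isTestFunctionGL_derivWeight hcpt hθ _)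
      hg₀.continuous hg₀s (hcoord b) h
  have hI2 : ∀ b b', Integrable fun x => g₀ x * ((stdBasis K).repr x b * (stdBasis K).repr x b' *
      leftTranslateWeight (n := 2) (archUnipotentGL K x) (derivWeight (AutomorphyDatum.gl 2 K hcpt).ofArch
        (toLie hcpt ((stdBasis K b * stdBasis K b') • adTerm₂ (X : Matrix (Fin 2) (Fin 2) (mixedSpace K)))) θ) h) := by
    intro b b'
    simpa only [mul_assoc] using integrable_kernel_mul_leftTranslate (isTestFunctionGL_derivWeight hcpt hθ _)
      hg₀.continuous hg₀s (q := fun x => (stdBasis K).repr x b * (stdBasis K).repr x b')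
      ((hcoord b).mul (hcoord b')) h
  have hQ : Integrable fun x => ∑ b, g₀ x * ((stdBasis K).repr x b *
      leftTranslateWeight (n := 2) (archUnipotentGL K x) (derivWeight (AutomorphyDatum.gl 2 K hcpt).ofArch
        (toLie hcpt ((stdBasis K b) • adTerm₁ (X : Matrix (Fin 2) (Fin 2) (mixedSpace K)))) θ) h) :=
    integrable_finsetSum _ fun b _ => hI1 b
  have hR : Integrable fun x => ∑ b, ∑ b', g₀ x * ((stdBasis K).repr x b * (stdBasis K).repr x b' *
      leftTranslateWeight (n := 2) (archUnipotentGL K x) (derivWeight (AutomorphyDatum.gl 2 K hcpt).ofArch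
        (toLie hcpt ((stdBasis K b * stdBasis K b') • adTerm₂ (X : Matrix (Fin 2) (Fin 2) (mixedSpace K)))) θ) h) :=
    integrable_finsetSum _ fun b _ => integrable_finsetSum _ fun b' _ => hI2 b b'
  have hPQ : Integrable fun x => g₀ x * leftTranslateWeight (n := 2) (archUnipotentGL K x)
      (derivWeight (AutomorphyDatum.gl 2 K hcpt).ofArch X θ) h +
      ∑ b, g₀ x * ((stdBasis K).repr x b *
        leftTranslateWeight (n := 2) (archUnipotentGL K x) (derivWeight (AutomorphyDatum.gl 2 K hcpt).ofArch
          (toLie hcpt ((stdBasis K b) • adTerm₁ (X : Matrix (Fin 2) (Fin 2) (mixedSpace K)))) θ) h) := hI0.add hQ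
  rw [integral_add hPQ hR, integral_add hI0 hQ, integral_finsetSum _ (fun b _ => hI1 b),
    integral_finsetSum _ (fun b _ => (integrable_finsetSum _ fun b' _ => hI2 b b'))]
  simp_rw [integral_finsetSum _ (fun b' _ => hI2 _ b')]
  simp only [archUnipotentConv_apply_gl]
  congr 1
  · congr 1
    refine Finset.sum_congr rfl fun b _ => integral_congr_ae (ae_of_all _ fun x => ?_)
    show _ = (stdBasis K).repr x b * g₀ x * _
    simp only [leftTranslateWeight_apply]
    ring
  · refine Finset.sum_congr rfl fun b _ => Finset.sum_congr rfl fun b' _ => integral_congr_ae (ae_of_all _ fun x => ?_)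
    show _ = (stdBasis K).repr x b * (stdBasis K).repr x b' * g₀ x * _
    simp only [leftTranslateWeight_apply]
    ring

end Literature.NumberTheory.Automorphic
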